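/-
Copyright (c) 2026 the pub-hodgecm-mathlib formalisation cell (harness21).  Prover seat hodgecm-mathlib-LH4-p04 (g2), req620 Track A «(D-RAM) FOUR-FRAME» squad
(MS ROAD A, STAGE B brick B3₂ «TYPE-2 STRATA TABLE» — part 6a: THE INTEGER SIEVE (the ⌊·∕2⌋-parity enumeration behind the type-2 candidate table)).  2026-09-04.
-/
import Mathlib.Tactic
import HarnessLib

/-!
# Crux `H413`, line LH4 «(D-RAM) FOUR-FRAME» road — unit U3_Laws (iii), MS ROAD A, STAGE B brick B3₂ (part 6a): THE INTEGER SIEVE — which exponent patterns `(b, c, v z, v(xz − yϖ^b))`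
# of a normalised HNF lattice survive `|D_i| = exp(2⌊a_i∕2⌋)` and `Σ⌊a_i∕2⌋ = b + c − 1` (the type-2 determinant condition)

Cell `hodgecm-mathlib` (D-0151), FLOOR 0, crux item H413 = `stmt-HodgeConjecture-24833`, route of record `HCCMUnconditional`; squad F0∕P3c∕LH4 (req618∕req620); registered stub served:
`F0P3cDyRamFourFrameU3.stub_U3_stableModelSum` (MS).  THEOREMS ONLY (no `def`, no instance, no notation, no `sorry`, default heartbeats); lane
`--supports stmt-HodgeConjecture-24833 --as helper` (count-neutral).  STAGE B type-2 twin (LH4-p10 (g2) `MEMO-stableLaw-finite.v2.1-type2` §T2.0–§T2.1; this seat's census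
`F0/P3c/LH4/LH4-p04/g2/CENSUS-B3type2.v1.LH4p04g2.md` §1).  PURE INTEGER ARITHMETIC (no field, no valuation): part 6b feeds it the exponents of a type-2 polarised HNF lattice
(★ part 5 `dualFrame_sandwich` + `gram_values_of_type`) and reads the conclusion back in valuation currency.

THE MATHEMATICS (census §1).  For the HNF lattice `(1 0 0; x ϖ^b 0; y z ϖ^c)·𝒪³` write `m = v z`, `w = v(xz − yϖ^b)` (capped at a large value when the element vanishes), so that the
axis exponents are `a₀ = max(b, b + c − w)`, `a₁ = max(b, b + c − m)`, `a₂ = c` (MEMO v2 §1 ∕ ★ B2), and let `|D_i| = exp(2f_i)` for the polarising form.  The type-2 conditions give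
the SANDWICH `a_i − 1 ≤ 2f_i ≤ a_i` (★ part 5) and the DETERMINANT identity `f₀ + f₁ + f₂ = b + c − 1`; normalisation and the ultrametric inequality give the four RELATIONS
(R1) `b = 0, c ≥ 1, m ≥ 1 ⇒ w = 0`; (R2) `b ≥ 1, c ≥ 1, m > b ⇒ w = b`; (R3) `b ≥ 1, m < b ⇒ w = m`; (R4) `b ≥ 1, m = b ⇒ w ≥ b`.  The parity bookkeeping
`a₀ + a₁ + a₂ − (a₀ mod 2) − (a₁ mod 2) − (a₂ mod 2) = 2(b + c − 1)` then leaves EXACTLY: the genuine type-2 strata — T₃ (`c = 0`, `b` odd), T₁∕T₂ (`b = 0`, `c` odd, `m = 0, w ≥ c` ∕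
`m ≥ c`), their `r = 1` glued and hanging neighbours (`b = 0`, `c` odd, `m = 0, w = c − 1` ∕ `m = c − 1` ∕ `c = 1, m = w = 0`), G₁ (`m = b ≥ 1`, `c` odd `≥ 2b + 3`, `w = c − b − 1`),
H (`m = b ≥ 1`, `c = 2b + 1`, `w = b`), G₂ (`b ≥ 1`, `c` odd `≥ 2b+3`, `m = c − b − 1`), G₃ (`m < b`, `c = 2m + 1`, `b + m` even) — AND eleven residual families X1–X11 (census §1),
which are NOT polarisable but die only on the Gram ∕ dual-Gram ENTRIES (separate bricks).  For `b = 0` and for `c = 0` the sieve alone is already the genuine list.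

WHAT IS PROVED.  HEAD `typeTwo_sieve_int` — the complete case list as a 21-way disjunction in the integers `(b, c, m, w)`.
HONEST LABEL.  Count-neutral (`--supports`); nothing printed is asserted; (MS) stays a PROVER TARGET (empirical census law — MEMO v2∕v2.1 is its paper proof); `HC_CM` is proved only
modulo the 7 printed citations (2 remaining named inputs: hLiu418 = `stmt-HodgeConjecture-24832`, h413 = `stmt-HodgeConjecture-24833`) until rung 0 closes.

## References
* [Jacobowitz1962] R. Jacobowitz, *Hermitian forms over local fields*, Amer. J. Math. 84 (1962), §7–§8 (`𝔭`-modular lattices: `𝔭M^♯ ⊆ M ⊆ M^♯`, the determinant type).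
* [Kottwitz1986BaseChangeUnits] R. E. Kottwitz, *Base change for unit elements of Hecke algebras*, Compositio Math. 60 (1986), §1 pp. 240–241 (fixed lattices counted by position).
* [Serre1980Trees] J.-P. Serre, *Trees*, Springer (1980), Ch. II §1.1 (Hermite normal forms, coordinate axes).
-/

set_option autoImplicit false

namespace Summit.HodgeConjecture.HodgeConjecture.Cruxes.H413.F0P3cDyRamDiagonalTypeTwoSieveInt

/-- **THE INTEGER SIEVE OF THE TYPE-2 STRATA TABLE** (census §1).  Inputs: `b c m w : ℕ` (HNF exponents, `m = v z`, `w = v(xz − yϖ^b)`, both possibly capped above every threshold),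
`f₀ f₁ f₂ : ℤ` (half-valuations of the polarising form) with the SANDWICH `max(b, b+c−w) − 1 ≤ 2f₀ ≤ max(b, b+c−w)`, `max(b, b+c−m) − 1 ≤ 2f₁ ≤ max(b, b+c−m)`, `c − 1 ≤ 2f₂ ≤ c`,
the DETERMINANT identity `f₀ + f₁ + f₂ = b + c − 1`, and the RELATIONS (R1)–(R4).  Output: one of the ten genuine patterns (T₃; T₁, G₁(1,·), H(1); T₂, G₂(1,·); G₁; H; G₂; G₃) or one of
the eleven residual patterns X1–X11 (census §1), each with its exact side conditions. [cite: Jacobowitz1962, §7–§8] [cite: Kottwitz1986BaseChangeUnits, §1 pp. 240–241]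
[cite: Serre1980Trees, II §1.1] -/
theorem typeTwo_sieve_int (b c m w : ℕ) (f₀ f₁ f₂ : ℤ)
    (hS0l : max (b : ℤ) (b + c - w) - 1 ≤ 2 * f₀) (hS0u : 2 * f₀ ≤ max (b : ℤ) (b + c - w))
    (hS1l : max (b : ℤ) (b + c - m) - 1 ≤ 2 * f₁) (hS1u : 2 * f₁ ≤ max (b : ℤ) (b + c - m))
    (hS2l : (c : ℤ) - 1 ≤ 2 * f₂) (hS2u : 2 * f₂ ≤ c) (hdet : f₀ + f₁ + f₂ = b + c - 1)
    (R1 : b = 0 → 1 ≤ c → 1 ≤ m → w = 0) (R2 : 1 ≤ b → 1 ≤ c → b < m → w = b) (R3 : 1 ≤ b → m < b → w = m) (R4 : 1 ≤ b → m = b → b ≤ w) :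
    -- genuine, `c = 0`: T₃ (`b` odd)
    (c = 0 ∧ b % 2 = 1) ∨
    -- genuine, `b = 0`: T₁(c); G₁(1, c−1); H(1); T₂(c); G₂(1, c−1)
    (b = 0 ∧ c % 2 = 1 ∧ m = 0 ∧ c ≤ w) ∨ (b = 0 ∧ c % 2 = 1 ∧ 3 ≤ c ∧ m = 0 ∧ w = c - 1) ∨ (b = 0 ∧ c = 1 ∧ m = 0 ∧ w = 0) ∨
    (b = 0 ∧ c % 2 = 1 ∧ c ≤ m) ∨ (b = 0 ∧ c % 2 = 1 ∧ 3 ≤ c ∧ m = c - 1) ∨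
    -- genuine, `b ≥ 1`: G₁(2b+1, c−2b−1); H(2b+1); G₂(2b+1, c−2b−1); G₃(2m+1, b−m)
    (1 ≤ b ∧ m = b ∧ c % 2 = 1 ∧ 2 * b + 3 ≤ c ∧ w = c - b - 1) ∨ (1 ≤ b ∧ m = b ∧ c = 2 * b + 1 ∧ w = b) ∨
    (1 ≤ b ∧ c % 2 = 1 ∧ 2 * b + 3 ≤ c ∧ m = c - b - 1) ∨ (1 ≤ b ∧ m < b ∧ c = 2 * m + 1 ∧ (b + m) % 2 = 0) ∨
    -- residual X1–X5
    (2 ≤ b ∧ b % 2 = 0 ∧ (c = 1 ∨ c = 2) ∧ c ≤ m ∧ c ≤ w) ∨ ((b = 1 ∨ b = 2) ∧ c % 2 = 0 ∧ 2 * b ≤ c ∧ c ≤ m ∧ w = b) ∨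
    (1 ≤ b ∧ c % 2 = 1 ∧ 2 * b < c ∧ m = c - b ∧ w = b) ∨ (2 ≤ b ∧ c % 2 = 0 ∧ 2 * b ≤ c ∧ m = c - b + 1 ∧ w = b) ∨
    (3 ≤ b ∧ c % 2 = 0 ∧ 2 * b ≤ c ∧ m = c - b + 2 ∧ w = b) ∨
    -- residual X6–X8
    (2 ≤ m ∧ m < b ∧ c = 2 * m - 1 ∧ (b + m) % 2 = 1 ∧ w = m) ∨ (1 ≤ m ∧ m < b ∧ c = 2 * m ∧ (b + m) % 2 = 1 ∧ w = m) ∨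
    (3 ≤ m ∧ m < b ∧ c = 2 * m - 2 ∧ (b + m) % 2 = 0 ∧ w = m) ∨
    -- residual X9–X11
    (1 ≤ b ∧ m = b ∧ c % 2 = 1 ∧ 2 * b + 1 ≤ c ∧ w = c - b) ∨
    (1 ≤ b ∧ m = b ∧ c % 2 = 0 ∧ b < c ∧ ((b = 1 ∧ c ≤ w) ∨ (2 ≤ b ∧ 2 * b ≤ c ∧ w = c - b + 1))) ∨
    (2 ≤ b ∧ m = b ∧ c % 2 = 0 ∧ b < c ∧ ((b = 2 ∧ c ≤ w) ∨ (3 ≤ b ∧ 2 * b - 2 ≤ c ∧ w = c - b + 2))) := by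
  rcases Nat.eq_zero_or_pos c with hc0 | hc1
  · -- `c = 0`: `2f₂ = 0`, `a₀ = a₁ = b`, so `f₀ + f₁ = b − 1` forces `b` odd
    subst hc0
    left
    refine ⟨rfl, ?_⟩
    have h0 : max (b : ℤ) (b + 0 - w) = b := max_eq_left (by omega)
    have h1 : max (b : ℤ) (b + 0 - m) = b := max_eq_left (by omega)
    push_cast at hS0l hS0u hS1l hS1u hdet
    rw [h0] at hS0l hS0u
    rw [h1] at hS1l hS1u
    omega
  rcases Nat.eq_zero_or_pos b with hb0 | hb1
  · -- `b = 0`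
    subst hb0
    push_cast at hS0l hS0u hS1l hS1u hdet
    simp only [zero_add] at hS0l hS0u hS1l hS1u hdet
    rcases Nat.eq_zero_or_pos m with hm0 | hm1
    · -- `m = 0`: `a₁ = c`, so `f₁ = f₂ = ⌊c∕2⌋`, `f₀ ∈ {0, −1}`: `c` odd, `f₀ = 0`, `w ≥ c − 1`
      subst hm0
      have h1 : max (0 : ℤ) (c - (0 : ℕ)) = c := by push_cast; exact max_eq_right (by omega)
      rw [h1] at hS1l hS1u
      -- `a₀ = max(0, c − w)`
      rcases le_or_gt c w with hcw | hwc
      · have h0 : max (0 : ℤ) (c - w) = 0 := max_eq_left (by omega)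
        rw [h0] at hS0l hS0u
        exact Or.inr (Or.inl ⟨rfl, by omega, rfl, hcw⟩)
      · have h0 : max (0 : ℤ) (c - w) = c - w := max_eq_right (by omega)
        rw [h0] at hS0l hS0u
        rcases Nat.eq_zero_or_pos w with hw0 | hw1
        · subst hw0
          exact Or.inr (Or.inr (Or.inr (Or.inl ⟨rfl, by omega, rfl, rfl⟩)))
        · exact Or.inr (Or.inr (Or.inl ⟨rfl, by omega, by omega, rfl, by omega⟩))
    · -- `m ≥ 1`: `w = 0` (R1), `a₀ = c`: `c` odd, `f₁ = 0`, `m ≥ c − 1`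
      have hw : w = 0 := R1 rfl hc1 hm1
      subst hw
      have h0 : max (0 : ℤ) (c - (0 : ℕ)) = c := by push_cast; exact max_eq_right (by omega)
      rw [h0] at hS0l hS0u
      rcases le_or_gt c m with hcm | hmc
      · have h1 : max (0 : ℤ) (c - m) = 0 := max_eq_left (by omega)
        rw [h1] at hS1l hS1u
        exact Or.inr (Or.inr (Or.inr (Or.inr (Or.inl ⟨rfl, by omega, hcm⟩))))
      · have h1 : max (0 : ℤ) (c - m) = c - m := max_eq_right (by omega)
        rw [h1] at hS1l hS1u
        exact Or.inr (Or.inr (Or.inr (Or.inr (Or.inr (Or.inl ⟨rfl, by omega, by omega, by omega⟩)))))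
  · -- `b ≥ 1`
    rcases lt_trichotomy m b with hmb | hmb | hmb
    · -- `m < b`: `w = m` (R3), `a₀ = a₁ = b + c − m`
      have hw : w = m := R3 hb1 hmb
      subst hw
      have hmc : w < c ∨ c ≤ w := lt_or_ge w c
      rcases hmc with hwc | hcw
      · have h0 : max (b : ℤ) (b + c - w) = b + c - w := max_eq_right (by omega)
        rw [h0] at hS0l hS0u hS1l hS1u
        -- `c ∈ {2w−2, 2w−1, 2w, 2w+1}` by parity bookkeeping
        have hc4 : (c : ℤ) = 2 * w + 1 ∧ (b + w) % 2 = 0 ∨ (c : ℤ) = 2 * w - 1 ∧ (b + w) % 2 = 1 ∨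
            (c : ℤ) = 2 * w ∧ (b + w) % 2 = 1 ∨ (c : ℤ) = 2 * w - 2 ∧ (b + w) % 2 = 0 := by omega
        rcases hc4 with ⟨hc, hp⟩ | ⟨hc, hp⟩ | ⟨hc, hp⟩ | ⟨hc, hp⟩
        · exact Or.inr (Or.inr (Or.inr (Or.inr (Or.inr (Or.inr (Or.inr (Or.inr (Or.inr (Or.inl ⟨hb1, hmb, by omega, by omega⟩)))))))))
        · -- X6
          refine Or.inr (Or.inr (Or.inr (Or.inr (Or.inr (Or.inr (Or.inr (Or.inr (Or.inr (Or.inr (Or.inr (Or.inr (Or.inr (Or.inr (Or.inr (Or.inl ?_)))))))))))))))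
          exact ⟨by omega, hmb, by omega, by omega, rfl⟩
        · -- X7
          refine Or.inr (Or.inr (Or.inr (Or.inr (Or.inr (Or.inr (Or.inr (Or.inr (Or.inr (Or.inr (Or.inr (Or.inr (Or.inr (Or.inr (Or.inr (Or.inr (Or.inl ?_))))))))))))))))
          exact ⟨by omega, hmb, by omega, by omega, rfl⟩
        · -- X8
          refine Or.inr (Or.inr (Or.inr (Or.inr (Or.inr (Or.inr (Or.inr (Or.inr (Or.inr (Or.inr (Or.inr (Or.inr (Or.inr (Or.inr (Or.inr (Or.inr (Or.inr (Or.inl ?_)))))))))))))))))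
          exact ⟨by omega, hmb, by omega, by omega, rfl⟩
      · -- `m < b` and `m ≥ c`: `a₀ = a₁ = b`: then `f₀ + f₁ ≤ b` but `f₂ ≤ c∕2` forces ... impossible unless handled: parity says `c ≤ 2` etc. — this is Case A of the census
        have h0 : max (b : ℤ) (b + c - w) = b := max_eq_left (by omega)
        rw [h0] at hS0l hS0u hS1l hS1u
        -- X1 (b even, c ∈ {1,2})
        refine Or.inr (Or.inr (Or.inr (Or.inr (Or.inr (Or.inr (Or.inr (Or.inr (Or.inr (Or.inr (Or.inl ⟨by omega, by omega, by omega, hcw, hcw⟩))))))))))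
    · -- `m = b`: `w ≥ b` (R4); `a₁ = max(b, c)`
      subst hmb
      have hwb : m ≤ w := R4 hb1 rfl
      rcases le_or_gt c m with hcm | hmc
      · -- `c ≤ b = m`: `a₀ = a₁ = b` (Case A with m = b): X1
        have h0 : max (m : ℤ) (m + c - w) = m := max_eq_left (by omega)
        have h1 : max (m : ℤ) (m + c - m) = m := max_eq_left (by omega)
        rw [h0] at hS0l hS0u
        rw [h1] at hS1l hS1u
        refine Or.inr (Or.inr (Or.inr (Or.inr (Or.inr (Or.inr (Or.inr (Or.inr (Or.inr (Or.inr (Or.inl ⟨by omega, by omega, by omega, hcm, by omega⟩))))))))))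
      · -- `c > b`: `a₁ = c`; `a₀ = max(b, b + c − w)`
        have h1 : max (m : ℤ) (m + c - m) = c := by rw [add_sub_cancel_left]; exact max_eq_right (by exact_mod_cast hmc.le)
        rw [h1] at hS1l hS1u
        rcases le_or_gt c w with hcw | hwc
        · -- `P = 0`: `a₀ = b`
          have h0 : max (m : ℤ) (m + c - w) = m := max_eq_left (by omega)
          rw [h0] at hS0l hS0u
          -- parity: `b − 2 + δ₀ + 2γ = 0` with P = 0: cases b = 1, c even (X10a) or b = 2, c even (X11a)
          have hbc : (m = 1 ∧ c % 2 = 0) ∨ (m = 2 ∧ c % 2 = 0) := by omega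
          rcases hbc with ⟨hm, hc⟩ | ⟨hm, hc⟩
          · refine Or.inr (Or.inr (Or.inr (Or.inr (Or.inr (Or.inr (Or.inr (Or.inr (Or.inr (Or.inr (Or.inr (Or.inr (Or.inr (Or.inr (Or.inr (Or.inr (Or.inr (Or.inr (Or.inr (Or.inl ?_)))))))))))))))))))
            exact ⟨hb1, rfl, hc, hmc, Or.inl ⟨hm, hcw⟩⟩
          · refine Or.inr (Or.inr (Or.inr (Or.inr (Or.inr (Or.inr (Or.inr (Or.inr (Or.inr (Or.inr (Or.inr (Or.inr (Or.inr (Or.inr (Or.inr (Or.inr (Or.inr (Or.inr (Or.inr (Or.inr ?_)))))))))))))))))))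
            exact ⟨by omega, rfl, hc, hmc, Or.inl ⟨hm, hcw⟩⟩
        · -- `P = c − w ≥ 1`
          have h0 : max (m : ℤ) (m + c - w) = m + c - w := max_eq_right (by omega)
          rw [h0] at hS0l hS0u
          -- parity bookkeeping: `c − w = b − 2 + δ₀ + 2γ`
          have hcase : ((c : ℤ) % 2 = 1 ∧ (w : ℤ) = c - m - 1) ∨ ((c : ℤ) % 2 = 1 ∧ (w : ℤ) = c - m) ∨
              ((c : ℤ) % 2 = 0 ∧ (w : ℤ) = c - m + 1) ∨ ((c : ℤ) % 2 = 0 ∧ (w : ℤ) = c - m + 2) := by omega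
          rcases hcase with ⟨hc, hw⟩ | ⟨hc, hw⟩ | ⟨hc, hw⟩ | ⟨hc, hw⟩
          · -- genuine G₁ ∕ H
            rcases eq_or_lt_of_le (show 2 * m + 1 ≤ c by omega) with hc' | hc'
            · exact Or.inr (Or.inr (Or.inr (Or.inr (Or.inr (Or.inr (Or.inr (Or.inl ⟨hb1, rfl, hc'.symm, by omega⟩)))))))
            · exact Or.inr (Or.inr (Or.inr (Or.inr (Or.inr (Or.inr (Or.inl ⟨hb1, rfl, by omega, by omega, by omega⟩))))))
          · -- X9
            refine Or.inr (Or.inr (Or.inr (Or.inr (Or.inr (Or.inr (Or.inr (Or.inr (Or.inr (Or.inr (Or.inr (Or.inr (Or.inr (Or.inr (Or.inr (Or.inr (Or.inr (Or.inr (Or.inl ?_))))))))))))))))))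
            exact ⟨hb1, rfl, by omega, by omega, by omega⟩
          · -- X10b
            refine Or.inr (Or.inr (Or.inr (Or.inr (Or.inr (Or.inr (Or.inr (Or.inr (Or.inr (Or.inr (Or.inr (Or.inr (Or.inr (Or.inr (Or.inr (Or.inr (Or.inr (Or.inr (Or.inr (Or.inl ?_)))))))))))))))))))
            exact ⟨hb1, rfl, by omega, hmc, Or.inr ⟨by omega, by omega, by omega⟩⟩
          · -- X11b
            refine Or.inr (Or.inr (Or.inr (Or.inr (Or.inr (Or.inr (Or.inr (Or.inr (Or.inr (Or.inr (Or.inr (Or.inr (Or.inr (Or.inr (Or.inr (Or.inr (Or.inr (Or.inr (Or.inr (Or.inr ?_)))))))))))))))))))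
            exact ⟨by omega, rfl, by omega, hmc, Or.inr ⟨by omega, by omega, by omega⟩⟩
    · -- `m > b`: then `a₁ = max(b, b + c − m)`; `w = b` when `c ≥ 1` (R2)
      have hw : w = b := R2 hb1 hc1 hmb
      subst hw
      rcases le_or_gt c m with hcm | hmc
      · -- `m ≥ c`: `a₁ = b`; `a₀ = max(b, c)`
        have h1 : max (w : ℤ) (w + c - m) = w := max_eq_left (by omega)
        rw [h1] at hS1l hS1u
        rcases le_or_gt c w with hcw | hwc
        · -- `a₀ = b`: X1
          have h0 : max (w : ℤ) (w + c - w) = w := max_eq_left (by omega)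
          rw [h0] at hS0l hS0u
          refine Or.inr (Or.inr (Or.inr (Or.inr (Or.inr (Or.inr (Or.inr (Or.inr (Or.inr (Or.inr (Or.inl ⟨by omega, by omega, by omega, hcm, hcw⟩))))))))))
        · -- `a₀ = c`: X2
          have h0 : max (w : ℤ) (w + c - w) = c := by rw [add_sub_cancel_left]; exact max_eq_right (by exact_mod_cast hwc.le)
          rw [h0] at hS0l hS0u
          refine Or.inr (Or.inr (Or.inr (Or.inr (Or.inr (Or.inr (Or.inr (Or.inr (Or.inr (Or.inr (Or.inr (Or.inl ⟨by omega, by omega, by omega, hcm, rfl⟩)))))))))))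
      · -- `b < m < c`: `a₀ = c`, `a₁ = b + c − m`: G₂ or X3∕X4∕X5
        have h0 : max (w : ℤ) (w + c - w) = c := by rw [add_sub_cancel_left]; exact max_eq_right (by omega)
        have h1 : max (w : ℤ) (w + c - m) = w + c - m := max_eq_right (by omega)
        rw [h0] at hS0l hS0u
        rw [h1] at hS1l hS1u
        have hcase : ((c : ℤ) % 2 = 1 ∧ (m : ℤ) = c - w - 1) ∨ ((c : ℤ) % 2 = 1 ∧ (m : ℤ) = c - w) ∨
            ((c : ℤ) % 2 = 0 ∧ (m : ℤ) = c - w + 1) ∨ ((c : ℤ) % 2 = 0 ∧ (m : ℤ) = c - w + 2) := by omega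
        rcases hcase with ⟨hc, hm⟩ | ⟨hc, hm⟩ | ⟨hc, hm⟩ | ⟨hc, hm⟩
        · exact Or.inr (Or.inr (Or.inr (Or.inr (Or.inr (Or.inr (Or.inr (Or.inr (Or.inl ⟨hb1, by omega, by omega, by omega⟩))))))))
        · refine Or.inr (Or.inr (Or.inr (Or.inr (Or.inr (Or.inr (Or.inr (Or.inr (Or.inr (Or.inr (Or.inr (Or.inr (Or.inl ?_))))))))))))
          exact ⟨hb1, by omega, by omega, by omega, rfl⟩
        · refine Or.inr (Or.inr (Or.inr (Or.inr (Or.inr (Or.inr (Or.inr (Or.inr (Or.inr (Or.inr (Or.inr (Or.inr (Or.inr (Or.inl ?_)))))))))))))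
          exact ⟨by omega, by omega, by omega, by omega, rfl⟩
        · refine Or.inr (Or.inr (Or.inr (Or.inr (Or.inr (Or.inr (Or.inr (Or.inr (Or.inr (Or.inr (Or.inr (Or.inr (Or.inr (Or.inr (Or.inl ?_))))))))))))))
          exact ⟨by omega, by omega, by omega, by omega, rfl⟩

end Summit.HodgeConjecture.HodgeConjecture.Cruxes.H413.F0P3cDyRamDiagonalTypeTwoSieveInt
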